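import Summits.HubbardSuperconductivity.HubbardLadder.Oct12It4RowOfH0

/-!
# Oct12TableRow — the cluster-cut row of ANY `D₄`-invariant integer weight table on the oct12 sites, from per-piece bounds ([C](d2), generic)

HONEST FRAMING: ladder R1–R4 with certified numbers; no claim on H/H₀.  Cell pub-hubbard, lane r2 (g44).  `Oct12It4Invariance` /
`Oct12It4RowOfH0` (r2 g43) do [C](b0″)+(d2) for the ONE table `wSymIt4`; this file states the same two steps once for an ARBITRARY
integer table `W : Fin 12 → Fin 12 → ℤ` with zero diagonal that is invariant under the eight site permutations `oct12SitePerm g`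
(both facts are `decide`d per cut), and an arbitrary positive scale `D`:
* `xTable W = Σ_{i,j} W i j • 𝐒_i·𝐒_j` commutes with the full symmetry representation `oct12SymRep 2` (`XInvariance`);
* from the twelve PER-PIECE weight-zero Rayleigh bounds `(D·σ)·‖P_b v‖² ≤ Re⟨P_b v, xTable W P_b v⟩` (`P_b = oct12Piece b`, `S^z_tot v = 0`)
  — exactly what a kernel frame certificate per piece delivers — the torus WINDOW ROW
  `σ ≤ Σ_{i,j} (W i j / D) · 3 c_L(|xᵢ−xⱼ|, |yᵢ−yⱼ|)` for every `L ≥ 4` (`rayleigh_ge_of_pieces` → [D] `posSemidef_weightedPairOp_sub_of_h0`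
  → `weightedPairOp_realDiv` → `clusterCutRow_window`).
Per cut only the table literal, its two `decide`s and the `simp`/`norm_num` bookkeeping to the seven-class MANIFEST form remain
(`Oct12Adv06Rows`).  All [folklore].
-/

namespace Summit.HubbardSuperconductivity.HubbardLadder.ClusterCut

open Matrix Literature.MathematicalPhysics.QuantumLattice
open scoped ComplexOrder

/-! ## §1 The pair operator of an integer table and its symmetry -/

/-- The pair operator of an integer weight table on the twelve oct12 sites: `X_W = Σ_{i,j} W i j • 𝐒_i·𝐒_j` (spin ½). -/
noncomputable def xTable (W : Fin 12 → Fin 12 → ℤ) : Op (Fin 12) 2 := weightedPairOp 1 fun i j => ((W i j : ℤ) : ℂ)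

/-- Lattice half: for a `D₄`-invariant table, `permOp (oct12SitePerm g)` commutes with `X_W`. [folklore] -/
theorem permOp_mul_xTable (W : Fin 12 → Fin 12 → ℤ)
    (hinv : ∀ g : DihedralGroup 4, ∀ i j, W (oct12SitePerm g i) (oct12SitePerm g j) = W i j) (g : DihedralGroup 4) :
    permOp (oct12SitePerm g) * xTable W = xTable W * permOp (oct12SitePerm g) :=
  permOp_mul_weightedPairOp (oct12SitePerm g) 1 _ fun i j => by
    show ((W (oct12SitePerm g i) (oct12SitePerm g j) : ℤ) : ℂ) = W i j
    rw [hinv]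

/-- Flip half: for a table with zero diagonal, `flipOp` commutes with `X_W`. [folklore] -/
theorem flipOp_mul_xTable (W : Fin 12 → Fin 12 → ℤ) (hdiag : ∀ i, W i i = 0) :
    flipOp (Fin 12) 2 * xTable W = xTable W * flipOp (Fin 12) 2 :=
  toMatrix_mul_weightedPairOp (flipCfgPerm (Fin 12) 2) (fun σ => flipCfgPerm_apply σ) _ fun i => by
    show ((W i i : ℤ) : ℂ) = 0
    rw [hdiag]; simp

/-- **`hX` for any invariant table**: `X_W` commutes with the full symmetry representation `oct12SymRep 2`. [folklore] -/
theorem xTable_commute_oct12SymRep (W : Fin 12 → Fin 12 → ℤ) (hdiag : ∀ i, W i i = 0)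
    (hinv : ∀ g : DihedralGroup 4, ∀ i j, W (oct12SitePerm g i) (oct12SitePerm g j) = W i j)
    (g : DihedralGroup 4 × Multiplicative (ZMod 2)) :
    xTable W * oct12SymRep 2 g = oct12SymRep 2 g * xTable W := by
  obtain ⟨g, ε⟩ := g
  rw [oct12SymRep_apply]
  rcases zmod2_cases ε with rfl | rfl
  · rw [flipHom_one, Matrix.mul_one, permOp_mul_xTable W hinv]
  · rw [flipHom_gen]
    exact commute_mul_of_commute _ _ _ (permOp_mul_xTable W hinv g) (flipOp_mul_xTable W hdiag)

/-! ## §2 The window row of a table from the weight-zero Rayleigh bound -/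

/-- Rescaling a weight-zero Rayleigh bound from `X_W` (integer table, constant `D·s`) to `X_{W/D}` (constant `s`), `D > 0`. [folklore] -/
theorem h0_rescale_table (W : Fin 12 → Fin 12 → ℤ) (D : ℝ) (hD : 0 < D) {s : ℝ}
    (h0 : ∀ v : TensorIndex (Fin 12) 2 → ℂ, (totalSpin 1 2 : Op (Fin 12) 2) *ᵥ v = 0 →
      (D * s) * (star v ⬝ᵥ v).re ≤ (star v ⬝ᵥ xTable W *ᵥ v).re) :
    ∀ v : TensorIndex (Fin 12) 2 → ℂ, (totalSpin 1 2 : Op (Fin 12) 2) *ᵥ v = 0 →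
      s * (star v ⬝ᵥ v).re ≤ (star v ⬝ᵥ weightedPairOp 1 (fun i j => (((((W i j : ℤ) : ℝ) / D : ℝ)) : ℂ)) *ᵥ v).re := by
  intro v hv
  have h := h0 v hv
  have hX : weightedPairOp 1 (fun i j => (((((W i j : ℤ) : ℝ) / D : ℝ)) : ℂ)) = (((1 : ℝ) / D : ℝ) : ℂ) • xTable W := by
    unfold xTable
    exact weightedPairOp_realDiv 1 W D
  rw [hX, Matrix.smul_mulVec, dotProduct_smul, smul_eq_mul, Complex.mul_re, Complex.ofReal_re, Complex.ofReal_im, zero_mul,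
    sub_zero]
  have hn : 0 ≤ (star v ⬝ᵥ v).re := (Complex.nonneg_iff.mp (dotProduct_star_self_nonneg v)).1
  rw [div_mul_eq_mul_div, one_mul, le_div_iff₀ hD]
  nlinarith [h, hn]

/-- **The window row of an invariant table from the weight-zero Rayleigh bound**: if `(D·σ)·‖v‖² ≤ Re⟨v, X_W v⟩` on `S^z_tot v = 0`,
then `σ ≤ Σ_{i,j} (W i j / D) · 3 c_L(|xᵢ−xⱼ|, |yᵢ−yⱼ|)` on every torus `L ≥ 4` ([D] + [A]+[R]). [folklore] -/
theorem oct12_tableRow_of_h0 (W : Fin 12 → Fin 12 → ℤ) (hdiag : ∀ i, W i i = 0) (D : ℝ) (hD : 0 < D) {σ : ℝ}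
    (h0 : ∀ v : TensorIndex (Fin 12) 2 → ℂ, (totalSpin 1 2 : Op (Fin 12) 2) *ᵥ v = 0 →
      (D * σ) * (star v ⬝ᵥ v).re ≤ (star v ⬝ᵥ xTable W *ᵥ v).re)
    (L : ℕ) (hL : 4 ≤ L) :
    σ ≤ ∑ i, ∑ j, (((W i j : ℤ) : ℝ) / D) * (3 * heisRedCorr2 L 1 ((((siteOct12 i).1 : ℤ) - (siteOct12 j).1).natAbs)
      ((((siteOct12 i).2 : ℤ) - (siteOct12 j).2).natAbs)) := by
  haveI : NeZero L := ⟨by omega⟩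
  have hsite : ∀ i, (siteOct12 i).1 < L ∧ (siteOct12 i).2 < L := by
    intro i; fin_cases i <;> simp [siteOct12] <;> omega
  have hinj : Function.Injective siteOct12 := by decide
  have hw : ∀ i, (((W i i : ℤ) : ℝ) / D) = 0 := by
    intro i; simp [hdiag]
  have hpsd : ((∑ i, ∑ j, (((((W i j : ℤ) : ℝ) / D : ℝ)) : ℂ) • spinDot 1 i j : Op (Fin 12) 2)
      - ((σ : ℝ) : ℂ) • (1 : Op (Fin 12) 2)).PosSemidef :=
    posSemidef_weightedPairOp_sub_of_h0 (by decide) (fun i j => ((W i j : ℤ) : ℝ) / D) (h0_rescale_table W D hD h0)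
  exact clusterCutRow_window L siteOct12 hsite hinj (fun i j => ((W i j : ℤ) : ℝ) / D) hw _ hpsd

/-! ## §3 The window row of a table from the twelve per-piece bounds -/

/-- **The window row of an invariant table from per-piece bounds**: if on every symmetry piece `P_b = oct12Piece b` the weight-zero
Rayleigh bound `(D·σ)·‖P_b v‖² ≤ Re⟨P_b v, X_W P_b v⟩` holds (`S^z_tot v = 0`), the window row of §2 follows — pieces from `oct12_pieces`
with `hX := xTable_commute_oct12SymRep`, gluing by `rayleigh_ge_of_pieces`. [folklore] -/
theorem oct12_tableRow_of_hblk (W : Fin 12 → Fin 12 → ℤ) (hdiag : ∀ i, W i i = 0)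
    (hinv : ∀ g : DihedralGroup 4, ∀ i j, W (oct12SitePerm g i) (oct12SitePerm g j) = W i j) (D : ℝ) (hD : 0 < D) {σ : ℝ}
    (hblk : ∀ (b : Fin 12) (v : TensorIndex (Fin 12) 2 → ℂ), (totalSpin 1 2 : Op (Fin 12) 2) *ᵥ v = 0 →
      (D * σ) * (star (oct12Piece b *ᵥ v) ⬝ᵥ (oct12Piece b *ᵥ v)).re ≤
        (star (oct12Piece b *ᵥ v) ⬝ᵥ xTable W *ᵥ (oct12Piece b *ᵥ v)).re)
    (L : ℕ) (hL : 4 ≤ L) :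
    σ ≤ ∑ i, ∑ j, (((W i j : ℤ) : ℝ) / D) * (3 * heisRedCorr2 L 1 ((((siteOct12 i).1 : ℤ) - (siteOct12 j).1).natAbs)
      ((((siteOct12 i).2 : ℤ) - (siteOct12 j).2).natAbs)) := by
  obtain ⟨hherm, horth, hcomm, hsum⟩ :=
    oct12_pieces (oct12SymRep 2) (conjTranspose_oct12SymRep 2) (xTable_commute_oct12SymRep W hdiag hinv)
  refine oct12_tableRow_of_h0 W hdiag D hD (fun v hv => ?_) L hL
  exact rayleigh_ge_of_pieces (Z := (totalSpin 1 2 : Op (Fin 12) 2)) oct12Piece hherm horth hcomm (fun w _ => hsum w) hblk v hv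

end Summit.HubbardSuperconductivity.HubbardLadder.ClusterCut
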